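import Literature.AlgebraicGeometry.Motives.AbelianVarietyGoodReductionConjugateTate
import Mathlib.Data.Nat.Factorization.Induction
import HarnessLib

/-!
# Homomorphisms agreeing on the prime-power torsion agree on the `N`-torsion (primary decomposition)

[MumfordAV1970] D. Mumford, *Abelian varieties* (1970), §4 (the rational points form a commutative group) — the statement
is pure group theory: in a commutative group the `N`-torsion is generated by the `ℓᵐ`-torsion for the prime powers
`ℓᵐ ∣ N` (Bézout), so two homomorphisms which agree on every `A[ℓᵐ](k)` with `ℓᵐ ∣ N` agree on `A[N](k)`.
[Shimura1998] G. Shimura, *Abelian varieties with complex multiplication and modular functions* (1998), §18.6 proof of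
Thm. 18.6, p. 128: the congruence relation gives «`t^σ = κt`» on the `ℓ′`-power torsion for each prime `ℓ′ ∣ N` with
`𝔓 ∤ ℓ′`; the level-`N` clause needs it on all of `A[N]`.

Topic: bookkeeping for row II-1 S7a (piece G11a of the h21 programme).  Theorems only; no definition, no named fact.

## Main statements
* `MonoidHom.eq_on_pow_eq_one_of_coprime` — homomorphisms out of a commutative group agreeing on the `a`- and on the
  `b`-torsion, `a ⊥ b`, agree on the `ab`-torsion (Bézout).
* `MonoidHom.eq_on_pow_eq_one_of_forall_primePow` — agreeing on the `pᵐ`-torsion for every prime power `pᵐ ∣ N`, `N ≠ 0`,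
  they agree on the `N`-torsion.
* `AbelianVariety.forall_torsionPoints_eq_of_forall_primePow` — the same on `A[N](L)` (`torsionPoints`).
* `AbelianVariety.map_eq_conjPoints_of_forall_primePow` — «`κx = x^γ` on every `A[ℓᵐ](k)`, `ℓᵐ ∣ N` ⇒ on `A[N](k)`» in the
  currency `AlgPoints.map κ… x = A.conjPoints γ x` of the S7a harness.
-/

noncomputable section

open CategoryTheory

universe u

/-! ## §1. Group theory: agreement on coprime / prime-power torsion -/

namespace MonoidHom

variable {G H : Type*} [CommGroup G] [Group H]

/-- **Bézout**: if `f = g` on the `a`-torsion and on the `b`-torsion of a commutative group, with `a`, `b` coprime, then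
`f = g` on the `ab`-torsion (`x = (x^a)^u · (x^b)^v` for `u a + v b = 1`, where `x^a` is `b`-torsion and `x^b` is
`a`-torsion). [cite: MumfordAV1970, §4 (rational points form a commutative group)] -/
theorem eq_on_pow_eq_one_of_coprime (f g : G →* H) {a b : ℕ} (hab : Nat.Coprime a b)
    (ha : ∀ x : G, x ^ a = 1 → f x = g x) (hb : ∀ x : G, x ^ b = 1 → f x = g x)
    (x : G) (hx : x ^ (a * b) = 1) : f x = g x := by
  obtain ⟨u, v, huv⟩ := Nat.isCoprime_iff_coprime.mpr hab
  have hxa : (x ^ a) ^ b = 1 := by rw [← pow_mul, hx]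
  have hxb : (x ^ b) ^ a = 1 := by rw [← pow_mul, mul_comm, hx]
  have hsplit : (x ^ a) ^ u * (x ^ b) ^ v = x := by
    rw [← zpow_natCast x a, ← zpow_natCast x b, ← zpow_mul, ← zpow_mul, ← zpow_add,
      show (a : ℤ) * u + (b : ℤ) * v = 1 by linarith [huv], zpow_one]
  calc f x = f ((x ^ a) ^ u * (x ^ b) ^ v) := by rw [hsplit]
    _ = f (x ^ a) ^ u * f (x ^ b) ^ v := by rw [map_mul, map_zpow, map_zpow]
    _ = g (x ^ a) ^ u * g (x ^ b) ^ v := by rw [hb _ hxa, ha _ hxb]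
    _ = g ((x ^ a) ^ u * (x ^ b) ^ v) := by rw [map_mul, map_zpow, map_zpow]
    _ = g x := by rw [hsplit]

/-- **Primary decomposition**: if `f = g` on the `pᵐ`-torsion of a commutative group for every prime power `pᵐ ∣ N`
(`N ≠ 0`), then `f = g` on the `N`-torsion — induction over the coprime factorisation of the divisors of `N`
(`Nat.recOnPosPrimePosCoprime`) with `eq_on_pow_eq_one_of_coprime`. [cite: MumfordAV1970, §4] [cite: Shimura1998, §18.6 proof of Thm. 18.6, p. 128 («t^σ = κt by Proposition 16 of §11.2»)] -/
theorem eq_on_pow_eq_one_of_forall_primePow (f g : G →* H) {N : ℕ} (hN : N ≠ 0)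
    (h : ∀ p m : ℕ, p.Prime → 0 < m → p ^ m ∣ N → ∀ x : G, x ^ (p ^ m) = 1 → f x = g x) :
    ∀ x : G, x ^ N = 1 → f x = g x := by
  suffices key : ∀ n : ℕ, n ∣ N → ∀ x : G, x ^ n = 1 → f x = g x from key N dvd_rfl
  intro n
  induction n using Nat.recOnPosPrimePosCoprime with
  | prime_pow p m hp hm => exact fun hdvd => h p m hp hm hdvd
  | zero => exact fun h0 => absurd (zero_dvd_iff.mp h0) hN
  | one =>
    intro _ x hx
    rw [pow_one] at hx
    rw [hx, map_one, map_one]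
  | coprime a b _ _ hab iha ihb =>
    intro hdvd x hx
    exact eq_on_pow_eq_one_of_coprime f g hab (iha (dvd_of_mul_right_dvd hdvd)) (ihb (dvd_of_mul_left_dvd hdvd))
      x hx

end MonoidHom

/-! ## §2. On the points of an abelian variety -/

namespace Literature.AlgebraicGeometry.Motives

namespace AbelianVariety

variable {k : Type u} [Field k] {A B : AbelianVariety k} {L : Type u} [Field L] [Algebra k L]

/-- **Two homomorphisms `A(L) → B(L)` which agree on `A[pᵐ](L)` for every prime power `pᵐ ∣ N` agree on `A[N](L)`**
(`N ≠ 0`; the rational points form a commutative group, primary decomposition of its `N`-torsion).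
[cite: MumfordAV1970, §4 (rational points form a commutative group)] -/
theorem forall_torsionPoints_eq_of_forall_primePow (f g : A.Points L →* B.Points L) {N : ℕ} (hN : N ≠ 0)
    (h : ∀ p m : ℕ, p.Prime → 0 < m → p ^ m ∣ N →
      ∀ x : A.Points L, x ∈ A.torsionPoints L ((p ^ m : ℕ) : ℤ) → f x = g x) :
    ∀ x : A.Points L, x ∈ A.torsionPoints L (N : ℤ) → f x = g x := by
  intro x hx
  rw [mem_torsionPoints_iff, zpow_natCast] at hx
  refine MonoidHom.eq_on_pow_eq_one_of_forall_primePow f g hN (fun p m hp hm hdvd y hy => ?_) x hx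
  exact h p m hp hm hdvd y (by rw [mem_torsionPoints_iff, zpow_natCast]; exact hy)

/-- **«`κx = x^γ` on `A[N](k)` from the prime powers `ℓᵐ ∣ N`»** (the S7a harness currency): for `κ : A → A^γ` and
`γ ∈ Aut k`, if `AlgPoints.map κ x = conjPoints γ x` for every `x ∈ A[ℓᵐ](k)` and every prime power `ℓᵐ ∣ N` (`N ≠ 0`), then
the same holds for every `x ∈ A[N](k)` (`Hom.pointsMap κ` and `conjPoints γ` are group homomorphisms).
[cite: Shimura1998, §18.6 proof of Thm. 18.6, pp. 128–129 («t^σ = κt» and «for every rational prime ℓ» p. 128; the ℓ-adic estimates pp. 128–129)] [cite: MumfordAV1970, §4] -/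
theorem map_eq_conjPoints_of_forall_primePow (A : AbelianVariety k) (γ : k ≃+* k) (κ : A ⟶ A.conjugate γ) {N : ℕ}
    (hN : N ≠ 0)
    (h : ∀ p m : ℕ, p.Prime → 0 < m → p ^ m ∣ N →
      ∀ x : A.Points k, x ∈ A.torsionPoints k ((p ^ m : ℕ) : ℤ) →
        AlgPoints.map κ.hom.hom.hom x = A.conjPoints γ x) :
    ∀ x : A.Points k, x ∈ A.torsionPoints k (N : ℤ) → AlgPoints.map κ.hom.hom.hom x = A.conjPoints γ x := by
  intro x hx
  have key := forall_torsionPoints_eq_of_forall_primePow (Hom.pointsMap κ) (A.conjPoints γ).toMonoidHom hN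
    (fun p m hp hm hdvd y hy => by
      rw [Hom.pointsMap_apply, MulEquiv.coe_toMonoidHom]
      exact h p m hp hm hdvd y hy) x hx
  rwa [Hom.pointsMap_apply, MulEquiv.coe_toMonoidHom] at key

end AbelianVariety

end Literature.AlgebraicGeometry.Motives

end
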